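import Literature.AnabelianGeometry.AbsoluteAnabelian.AbsTopIII.FrobeniusPictureMLFCores
import Literature.AnabelianGeometry.AbsoluteAnabelian.DiagramUniversalTelecores

/-!
# [AbsTopIII] Corollary 3.6 (ii): CONSTRUCTION of the telecore `𝔗_An` and of its contact structure `ℋ_An`

S. Mochizuki, *Topics in Absolute Anabelian Geometry III*, Cor. 3.6 (ii) pp. 79–80 (manuscript
`paper:url-5493eb38cbb7`; bib key `MochizukiAbsTopIII2015`): "`φ_An` gives rise to a telecore
structure `𝔗_An` on `𝒟_{≤4}`, whose underlying diagram of categories we denote by `𝒟_An`, by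
appending to `𝒟_{≤5}` telecore edges … from the core `Anab` to the various copies of `𝒳` in `𝒟_{≤2}`
given by copies of `φ_An`", and the `η_{□⋎}^{±1}`, `η_⋏^{±1}` "generate a contact structure `ℋ_An` on
the telecore `𝔗_An`".  Typed by seat abc-iut-L4-t5 as `LogFrobeniusData.TelecoreStmt τ`
(`FrobeniusPictureMLFTelecore.lean`); seat abc-iut-L4-t10's Cor. 4.5 (ii) is literally the same
statement (`AbsTopIII.Cor_4_5_ii := Δ.TelecoreStmt τ`).

This file and its continuation `FrobeniusPictureMLFTelecoreProofs.lean` PROVE `TelecoreStmt τ`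
for every abstract input `Δ : LogFrobeniusData` and first-row telecore data `τ = (φ₁, e, η₁)`
such that

* `id_⋎ = toNexus : 𝒳₁ ⥤ 𝒳` is fully faithful — the printed case is `𝒳₁ = 𝒳`, `id_⋎ = 𝟭`;
* `η₁` is the isomorphism "arising from `η_An`" (p. 79): `id_⋎ ∘ η₁ = (e ▷ π_An) ∘ (η_An ◁ id_⋎)`
  componentwise (`hτ`) — automatic in the printed case `φ₁ = φ_An`, `e = 𝟙`, `η₁ = η_An`, and
  NECESSARY in general: compatibility of `ℋ_An` with the telecore family forces it (the pair
  `([β¹_⋎]∘[φ_⋎], [φ_⋎])` is both a whiskered contact generator and a telecore pair).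

Construction (proof of Cor. 3.6 (i)–(ii), p. 80: "the algorithms of Corollary 1.10 are
group-theoretic", i.e. every functor of `𝒟_An` lies over the base): every category of `𝒟_An` carries a
structure functor to `𝒳` (`id_⋎` on the first row, `𝟭` at `□`, `κ_An ∘ (𝒩 → ℰ)` followed by `φ_An` on
`𝒩`, `φ_An ∘ κ_An` on `ℰ`, `φ_An` on `Anab`) and every functor of `𝒟_An` lies over `𝒳` up to the
isomorphisms `log ≅ 𝟭`, `η_An` (on `λ^×`, `λ^{×pf}`), `e` (on `φ_⋎`) and identities (`overX`,
`anCI`, `anCJ`).  These structure functors are fully faithful at every vertex except `𝒩`; the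
toolkit `DiagramUniversalTelecores` (seat abc-iut-L4-t5) then yields the core `(𝒟_{≤5}, Anab, ℋ)`
(a second proof of Cor. 3.6 (i), `n = 5`), the telecore `𝔗_An` of the printed shape with
`𝒥|_𝒮 = ℋ`, and the universal family `K` of `𝒟_An`; `ℋ_An` is `K` restricted to the saturation of
the printed generators (this file: `anTelecore`, `anContact`, of the printed shape, a contact
structure, generated by the printed pairs); its homotopies on the generators are COMPUTED to be
the printed ones (`η_{□⋎} = e⁻¹`, `η_□ = η_An`, `η_⋎ = η₁`) in the continuation file, which
assembles `telecoreStmt_of_coherent`.  Nothing here takes a side on inter-universal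
Teichmüller theory; [AbsTopIII] is a refereed paper and Cor. 3.6 (ii) is category theory over its
Def. 3.1 / Cor. 1.10 data.
-/

namespace Literature.AnabelianGeometry.AbsoluteAnabelian

open _root_.CategoryTheory _root_.Quiver

universe u

namespace LogFrobeniusData

open DiagramOfCategories

variable (Δ : LogFrobeniusData.{u})

/-! ### Every functor of `𝒟_{≤4}` lies over `𝒳` -/

/-- The structure functor to `𝒳` at each vertex of `𝒟_{≤4}`: `id_⋎` on the first row, `𝟭` at `□`,
`φ_An ∘ κ_An ∘ (𝒩 → ℰ)` at `𝒩`, `φ_An ∘ κ_An` at `ℰ` (rows 5, 6 do not occur; junk values).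
[cite: MochizukiAbsTopIII2015, Corollary 3.6 (ii) p.80] -/
def overXFunctor : (a : SubVertex {a : LFVertex | a.row ≤ 4}) → ((Δ.sub 4).obj a ⥤ Δ.X)
  | ⟨.row1 _, _⟩ => Δ.toNexus
  | ⟨.nexus, _⟩ => 𝟭 Δ.X
  | ⟨.third, _⟩ => Δ.NtoE ⋙ Δ.κ ⋙ Δ.φ
  | ⟨.fourth, _⟩ => Δ.κ ⋙ Δ.φ
  | ⟨.fifth, _⟩ => Δ.φ
  | ⟨.sixth, _⟩ => Δ.κ ⋙ Δ.φ

/-- Rows 5 and 6 are not vertices of `𝒟_{≤4}`. [cite: MochizukiAbsTopIII2015, Corollary 3.6 p.79] -/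
theorem not_fifth_le_four (h : LFVertex.fifth ∈ {a : LFVertex | a.row ≤ 4}) : False := by
  simp [LFVertex.row] at h

/-- **Every functor of `𝒟_{≤4}` lies over `𝒳`**: `log` via `log ≅ 𝟭`, `id_⋎` strictly, `λ^×` and
`λ^{×pf}` via `λ ⋙ (𝒩 → ℰ) = (𝒳 → ℰ)` and `η_An : φ_An ∘ κ_An ∘ (𝒳 → ℰ) ⥲ 𝟭`, the remaining edges
strictly (proof of Cor. 3.6 (i)/(ii), p. 80). [cite: MochizukiAbsTopIII2015, Corollary 3.6 (ii) p.80] -/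
def overX : (Δ.sub 4).OverData Δ.X where
  N := Δ.overXFunctor
  μ {a b} e := match a, b, e with
    | ⟨.row1 _, _⟩, ⟨.row1 _, _⟩, _ =>
      Functor.isoWhiskerRight Δ.logIsoId Δ.toNexus ≪≫ Δ.toNexus.leftUnitor
    | ⟨.row1 _, _⟩, ⟨.nexus, _⟩, _ => Δ.toNexus.rightUnitor
    | ⟨.nexus, _⟩, ⟨.third, _⟩, ⟨true⟩ =>
      eqToIso (show Δ.lamTimes ⋙ (Δ.NtoE ⋙ Δ.κ ⋙ Δ.φ) = Δ.XtoE ⋙ Δ.κ ⋙ Δ.φ by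
        rw [← Functor.assoc, Δ.lamTimes_NtoE]) ≪≫ Δ.η
    | ⟨.nexus, _⟩, ⟨.third, _⟩, ⟨false⟩ =>
      eqToIso (show Δ.lamPf ⋙ (Δ.NtoE ⋙ Δ.κ ⋙ Δ.φ) = Δ.XtoE ⋙ Δ.κ ⋙ Δ.φ by
        rw [← Functor.assoc, Δ.lamPf_NtoE]) ≪≫ Δ.η
    | ⟨.third, _⟩, ⟨.fourth, _⟩, _ => Iso.refl _
    | ⟨.fourth, _⟩, ⟨.fifth, _⟩, _ => Iso.refl _
    | ⟨.fifth, h⟩, ⟨.sixth, _⟩, _ => (not_fifth_le_four h).elim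
    | ⟨.row1 _, _⟩, ⟨.third, _⟩, e => PEmpty.elim e
    | ⟨.row1 _, _⟩, ⟨.fourth, _⟩, e => PEmpty.elim e
    | ⟨.row1 _, _⟩, ⟨.fifth, _⟩, e => PEmpty.elim e
    | ⟨.row1 _, _⟩, ⟨.sixth, _⟩, e => PEmpty.elim e
    | ⟨.nexus, _⟩, ⟨.row1 _, _⟩, e => PEmpty.elim e
    | ⟨.nexus, _⟩, ⟨.nexus, _⟩, e => PEmpty.elim e
    | ⟨.nexus, _⟩, ⟨.fourth, _⟩, e => PEmpty.elim e
    | ⟨.nexus, _⟩, ⟨.fifth, _⟩, e => PEmpty.elim e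
    | ⟨.nexus, _⟩, ⟨.sixth, _⟩, e => PEmpty.elim e
    | ⟨.third, _⟩, ⟨.row1 _, _⟩, e => PEmpty.elim e
    | ⟨.third, _⟩, ⟨.nexus, _⟩, e => PEmpty.elim e
    | ⟨.third, _⟩, ⟨.third, _⟩, e => PEmpty.elim e
    | ⟨.third, _⟩, ⟨.fifth, _⟩, e => PEmpty.elim e
    | ⟨.third, _⟩, ⟨.sixth, _⟩, e => PEmpty.elim e
    | ⟨.fourth, _⟩, ⟨.row1 _, _⟩, e => PEmpty.elim e
    | ⟨.fourth, _⟩, ⟨.nexus, _⟩, e => PEmpty.elim e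
    | ⟨.fourth, _⟩, ⟨.third, _⟩, e => PEmpty.elim e
    | ⟨.fourth, _⟩, ⟨.fourth, _⟩, e => PEmpty.elim e
    | ⟨.fourth, _⟩, ⟨.sixth, _⟩, e => PEmpty.elim e
    | ⟨.fifth, _⟩, ⟨.row1 _, _⟩, e => PEmpty.elim e
    | ⟨.fifth, _⟩, ⟨.nexus, _⟩, e => PEmpty.elim e
    | ⟨.fifth, _⟩, ⟨.third, _⟩, e => PEmpty.elim e
    | ⟨.fifth, _⟩, ⟨.fourth, _⟩, e => PEmpty.elim e
    | ⟨.fifth, _⟩, ⟨.fifth, _⟩, e => PEmpty.elim e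
    | ⟨.sixth, _⟩, ⟨.row1 _, _⟩, e => PEmpty.elim e
    | ⟨.sixth, _⟩, ⟨.nexus, _⟩, e => PEmpty.elim e
    | ⟨.sixth, _⟩, ⟨.third, _⟩, e => PEmpty.elim e
    | ⟨.sixth, _⟩, ⟨.fourth, _⟩, e => PEmpty.elim e
    | ⟨.sixth, _⟩, ⟨.fifth, _⟩, e => PEmpty.elim e
    | ⟨.sixth, _⟩, ⟨.sixth, _⟩, e => PEmpty.elim e

/-- The observation functor `κ_An` of `(𝒟_{≤5}, Anab)` lies over `𝒳`: `φ_An ∘ κ_An = φ_An ∘ κ_An`.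
[cite: MochizukiAbsTopIII2015, Corollary 3.6 (i) p.80] -/
def anCI : ∀ (a : SubVertex {a : LFVertex | a.row ≤ 4}) (i : coreI5.{u} a),
    Δ.coreExt5.obsMap i ⋙ Δ.φ ≅ Δ.overX.N a
  | ⟨.fourth, _⟩, _ => Iso.refl _
  | ⟨.row1 _, _⟩, i => PEmpty.elim i
  | ⟨.nexus, _⟩, i => PEmpty.elim i
  | ⟨.third, _⟩, i => PEmpty.elim i
  | ⟨.fifth, _⟩, i => PEmpty.elim i
  | ⟨.sixth, _⟩, i => PEmpty.elim i

/-! ### The telecore edges `φ_⋏`, `⋏ ∈ L† = L ∪ {□}` -/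

/-- The telecore edges of `𝔗_An`: exactly one edge `φ_⋏` from `Anab` to each vertex `⋏` of the first
two rows ("`⋏ ∈ L†`"), none to `𝒩`, `ℰ`. [cite: MochizukiAbsTopIII2015, Corollary 3.6 (ii) p.79] -/
def anJ : SubVertex {a : LFVertex | a.row ≤ 4} → Type u
  | ⟨.row1 _, _⟩ => PUnit
  | ⟨.nexus, _⟩ => PUnit
  | ⟨.third, _⟩ => PEmpty
  | ⟨.fourth, _⟩ => PEmpty
  | ⟨.fifth, _⟩ => PEmpty
  | ⟨.sixth, _⟩ => PEmpty

variable (τ : Δ.TelecoreData)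

/-- The functors on the telecore edges: "copies of `φ_An`" — `φ_□ = φ_An` at the nexus and `φ_⋎ = φ₁`
(`= φ_An` in print, see `TelecoreData`) on the first row. [cite: MochizukiAbsTopIII2015, Corollary 3.6 (ii) p.79] -/
def anTelMap : ∀ {a : SubVertex {a : LFVertex | a.row ≤ 4}}, anJ.{u} a → (Δ.A ⥤ (Δ.sub 4).obj a)
  | ⟨.row1 _, _⟩, _ => τ.φ₁
  | ⟨.nexus, _⟩, _ => Δ.φ
  | ⟨.third, _⟩, j => PEmpty.elim j
  | ⟨.fourth, _⟩, j => PEmpty.elim j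
  | ⟨.fifth, _⟩, j => PEmpty.elim j
  | ⟨.sixth, _⟩, j => PEmpty.elim j

/-- The telecore functors lie over `𝒳`: `id_⋎ ∘ φ_⋎ ≅ φ_An` is `e` (the identity in print),
`𝟭 ∘ φ_□ = φ_An`. [cite: MochizukiAbsTopIII2015, Corollary 3.6 (ii) p.79] -/
def anCJ : ∀ (a : SubVertex {a : LFVertex | a.row ≤ 4}) (j : anJ.{u} a),
    Δ.anTelMap τ j ⋙ Δ.overX.N a ≅ Δ.φ
  | ⟨.row1 _, _⟩, _ => τ.e
  | ⟨.nexus, _⟩, _ => Δ.φ.rightUnitor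
  | ⟨.third, _⟩, j => PEmpty.elim j
  | ⟨.fourth, _⟩, j => PEmpty.elim j
  | ⟨.fifth, _⟩, j => PEmpty.elim j
  | ⟨.sixth, _⟩, j => PEmpty.elim j

/-- No telecore edges in the observable shape `(𝒟_{≤5}, Anab)`. [folklore] -/
private theorem coreShape5_isEmpty_J : ∀ a, IsEmpty (coreShape5.{u}.J a) :=
  fun _ => inferInstanceAs (IsEmpty PEmpty)

/-- `φ_An` is fully faithful (Cor. 3.6 (ii): `φ_An` is a functor "which is an equivalence of
categories"). [cite: MochizukiAbsTopIII2015, Corollary 3.6 (ii) p.79] -/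
noncomputable def ffφ : Δ.φ.FullyFaithful := by
  haveI := Δ.φ_equiv
  exact Functor.FullyFaithful.ofFullyFaithful Δ.φ

/-- `φ_An ∘ κ_An` is fully faithful (`κ_An`, `φ_An` equivalences). [cite: MochizukiAbsTopIII2015, Corollary 3.6 (ii) p.79] -/
noncomputable def ffκφ : (Δ.κ ⋙ Δ.φ).FullyFaithful := by
  haveI := Δ.φ_equiv
  haveI := Δ.κ_equiv
  exact (Functor.FullyFaithful.ofFullyFaithful Δ.κ).comp (Functor.FullyFaithful.ofFullyFaithful Δ.φ)

/-! ### The vertices with fully faithful structure functor: all but `𝒩` -/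

/-- The vertices of `𝒟_An` at which the structure functor to `𝒳` is fully faithful (given that
`id_⋎` is): `Anab`, `□`, the first row, `ℰ` — every vertex except `𝒩`. [folklore] -/
def anW : (teleShape anJ.{u}).Vertex → Prop
  | ExtVertex.obs => True
  | ExtVertex.base ⟨.row1 _, _⟩ => True
  | ExtVertex.base ⟨.nexus, _⟩ => True
  | ExtVertex.base ⟨.third, _⟩ => False
  | ExtVertex.base ⟨.fourth, _⟩ => True
  | ExtVertex.base ⟨.fifth, _⟩ => False
  | ExtVertex.base ⟨.sixth, _⟩ => False

/-- **The structure functors of `𝒟_An` over `𝒳`** (on `𝒟_{≤4}`: `overX`; `φ_An` at `Anab`; the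
telecore functors lie over `𝒳` by `anCJ`), as structure functors on the presentation
`teleDiagram` of `𝒟_An`. [cite: MochizukiAbsTopIII2015, Corollary 3.6 (ii) p.80] -/
noncomputable def anOver : (Δ.teleDiagram anJ (Δ.anTelMap τ)).OverData Δ.X :=
  teleOver coreShape5 Δ.coreExt5 Δ.overX Δ.φ Δ.anCI anJ (Δ.anTelMap τ) (Δ.anCJ τ)

/-- The fully faithful structures on `anW`. [folklore] -/
noncomputable def anFF (hν : Δ.toNexus.FullyFaithful) :
    ∀ w : (teleShape anJ.{u}).Vertex, anW w → ((Δ.anOver τ).N w).FullyFaithful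
  | ExtVertex.obs, _ => Δ.ffφ
  | ExtVertex.base ⟨.row1 _, _⟩, _ => hν
  | ExtVertex.base ⟨.nexus, _⟩, _ => Functor.FullyFaithful.id Δ.X
  | ExtVertex.base ⟨.third, _⟩, h => h.elim
  | ExtVertex.base ⟨.fourth, _⟩, _ => Δ.ffκφ
  | ExtVertex.base ⟨.fifth, _⟩, h => h.elim
  | ExtVertex.base ⟨.sixth, _⟩, h => h.elim

/-! ### The core `(𝒟_{≤5}, Anab)`, the telecore `𝔗_An`, the universal family, `ℋ_An` -/

section Construction

variable (hν : Δ.toNexus.FullyFaithful)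

/-- The core family `ℋ` of `(𝒟_{≤5}, Anab)` through the structure functors to `𝒳` (a second proof
of Cor. 3.6 (i), `n = 5`; its homotopies are the lifts through `φ_An`).
[cite: MochizukiAbsTopIII2015, Corollary 3.6 (i) p.79] -/
noncomputable def anCoreFamily : Δ.core5Diagram.HomotopyFamily :=
  univCoreFamily coreShape5 coreShape5_isEmpty_J Δ.coreExt5 Δ.overX Δ.φ Δ.anCI Δ.ffφ

/-- **The telecore `𝔗_An`** over the core `(𝒟_{≤5}, Anab, ℋ)`: edges `φ_⋏`, `⋏ ∈ L†`, family `𝒥`.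
[cite: MochizukiAbsTopIII2015, Corollary 3.6 (ii) p.79] -/
noncomputable def anTelecore :
    (Δ.sub 4).Telecore (Δ.coreObs5 (Δ.anCoreFamily) (univCoreFamily_terminal _ _ _ _ _ _ _))
      (univCoreObs_isCore coreShape5 coreShape5_isEmpty_J Δ.coreExt5 Δ.overX Δ.φ Δ.anCI Δ.ffφ
        reaches5) :=
  univTelecore coreShape5 coreShape5_isEmpty_J Δ.coreExt5 Δ.overX Δ.φ Δ.anCI Δ.ffφ anJ (Δ.anTelMap τ)
    (Δ.anCJ τ) anW (Δ.anFF τ hν) trivial reaches5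

/-- **The universal family `K` of `𝒟_An`** (boundary set: the pairs factoring through a vertex other
than `𝒩`). [cite: MochizukiAbsTopIII2015, Corollary 3.6 (ii) p.79] -/
noncomputable def anUniv : (Δ.teleDiagram anJ (Δ.anTelMap τ)).HomotopyFamily :=
  teleUnivFamily coreShape5 Δ.coreExt5 Δ.overX Δ.φ Δ.anCI anJ (Δ.anTelMap τ) (Δ.anCJ τ) anW (Δ.anFF τ hν)

/-- The printed generators of `ℋ_An` lie in the boundary set of `K` (they end at `□` or on the
first row). [cite: MochizukiAbsTopIII2015, Corollary 3.6 (ii) pp.79–80] -/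
theorem contactGen_subset ⦃a b : (teleShape anJ.{u}).Vertex⦄ ⦃p q : Path a b⦄
    (h : ContactGen p q) : (Δ.anUniv τ hν).E p q := by
  cases h with
  | etaSq n j jn => exact ⟨⟨tvNexus anJ, trivial, _, _, Path.nil, rfl, rfl⟩⟩
  | etaSqInv n j jn => exact ⟨⟨tvNexus anJ, trivial, _, _, Path.nil, rfl, rfl⟩⟩
  | etaNexus j => exact ⟨⟨tvNexus anJ, trivial, _, _, Path.nil, rfl, rfl⟩⟩
  | etaNexusInv j => exact ⟨⟨tvNexus anJ, trivial, _, _, Path.nil, rfl, rfl⟩⟩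
  | etaRow1 n jn => exact ⟨⟨tvRow1 anJ n, trivial, _, _, Path.nil, rfl, rfl⟩⟩
  | etaRow1Inv n jn => exact ⟨⟨tvRow1 anJ n, trivial, _, _, Path.nil, rfl, rfl⟩⟩

/-- **The contact structure `ℋ_An`**: the universal family restricted to the family GENERATED by the
printed pairs `{η_{□⋎}, η_{□⋎}⁻¹, η_⋏, η_⋏⁻¹}`. [cite: MochizukiAbsTopIII2015, Corollary 3.6 (ii) pp.79–80] -/
noncomputable def anContact : (Δ.teleDiagram anJ (Δ.anTelMap τ)).HomotopyFamily :=
  (Δ.anUniv τ hν).restrictBoundary (Saturation ContactGen) (isSaturated_saturation _)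
    (Saturation.subset (Δ.anUniv τ hν).isSaturated (Δ.contactGen_subset τ hν))

/-- `𝔗_An` has the printed shape: one edge `φ_⋏` to each `⋏ ∈ L†`, with functors `φ_An` / `φ₁`.
[cite: MochizukiAbsTopIII2015, Corollary 3.6 (ii) p.79] -/
theorem anTelecore_isTelecoreAn : Δ.IsTelecoreAn τ (Δ.anTelecore τ hν) where
  edges_iff a := by
    obtain ⟨a, ha⟩ := a
    cases a with
    | row1 n => exact ⟨fun _ => by simp [LFVertex.row], fun _ => ⟨PUnit.unit⟩⟩
    | nexus => exact ⟨fun _ => by simp [LFVertex.row], fun _ => ⟨PUnit.unit⟩⟩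
    | third => exact ⟨fun ⟨j⟩ => PEmpty.elim j, fun h => by simp [LFVertex.row] at h⟩
    | fourth => exact ⟨fun ⟨j⟩ => PEmpty.elim j, fun h => by simp [LFVertex.row] at h⟩
    | fifth => exact (not_fifth_le_four ha).elim
    | sixth => exact ⟨fun ⟨j⟩ => PEmpty.elim j, fun h => by simp [LFVertex.row] at h⟩
  edges_subsingleton a := by
    obtain ⟨a, ha⟩ := a
    cases a with
    | row1 n => exact inferInstanceAs (Subsingleton PUnit)
    | nexus => exact inferInstanceAs (Subsingleton PUnit)
    | third => exact inferInstanceAs (Subsingleton PEmpty)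
    | fourth => exact inferInstanceAs (Subsingleton PEmpty)
    | fifth => exact inferInstanceAs (Subsingleton PEmpty)
    | sixth => exact inferInstanceAs (Subsingleton PEmpty)
  telMap_nexus _ _ := rfl
  telMap_row1 _ _ _ := rfl

/-- `ℋ_An` is a contact structure for `𝔗_An` (compatible with `𝒥`: both are restrictions of `K`).
[cite: MochizukiAbsTopIII2015, Corollary 3.6 (ii) p.80] -/
theorem anContact_isContactStructure :
    Telecore.IsContactStructure (Δ.sub 4) (Δ.anTelecore τ hν) (Δ.anContact τ hν) :=
  isContactStructure_restrictBoundary _ _ _ _ _ _ _ _ _ _ _ _ _ _ _ _ _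

/-- `ℋ_An` is generated by the printed pairs. [cite: MochizukiAbsTopIII2015, Corollary 3.6 (ii) p.80] -/
theorem anContact_isGeneratedBy :
    HomotopyFamily.IsGeneratedBy _ (Δ.anContact τ hν) ContactGen := fun _ _ _ _ => Iff.rfl

end Construction

end LogFrobeniusData

end Literature.AnabelianGeometry.AbsoluteAnabelian
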